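import Literature.Probability.Percolation.KSTPeriodicClosing
import Literature.Probability.Percolation.KSTPeriodicQuasi
import Literature.Probability.Percolation.KSTPeriodicStatementsProofs

/-!
# Köhler-Schindler–Tassion, periodic form: Lemma 3 (`QuasiOfArms`) and Lemma 5 (`ClosingIneq`) hold

L. Köhler-Schindler, V. Tassion, *Crossing probabilities for planar percolation* (2023), Lemma 3 and
Lemma 5 with Comment 1 (periodic form).  The tree proves the conditional forms `quasiOfArms_of`
(granted `TopSideToLeftMeetsTB`, `TopSideToRightMeetsTB`, `AlternatingTBMeet`, `CorridorA`) and
`closingIneq_of` (granted `PartsMeetMPath`), and — in `KSTPeriodicStatementsProofs` /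
`KSTPeriodicTopologyII` — every one of those topological inputs (`…_holds`).  This leaf composes them,
so that the parametric named facts `QuasiOfArms` and `ClosingIneq` of `KSTPeriodicStatements` carry
their `_holds` (D-0026 bookkeeping: proof terms are existing theorems of the tree composed; no
statement, definition or attribute is edited; no new named fact).

## References

* L. Köhler-Schindler, V. Tassion, *Crossing probabilities for planar percolation*, Duke Math. J.
  172 (2023), Lemma 3, Lemma 5, Comment 1. [KohlerSchindlerTassion2023]
-/

namespace Literature.Probability.Percolation

namespace KSTPeriodic

/-- **Lemma 3, weak periodic form** (arm bounds at all large scales give quasi-crossings of the big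
box), unconditionally for every `k t`: `quasiOfArms_of` fed with the proved topological inputs
`TopSideToLeftMeetsTB_holds`, `TopSideToRightMeetsTB_holds`, `AlternatingTBMeet_holds`,
`CorridorA_holds`. [cite: KohlerSchindlerTassion2023, Lemma 3 and Comment 1] -/
theorem QuasiOfArms_holds (k t : ℕ) : Literature.Probability.Percolation.KSTPeriodic.QuasiOfArms k t :=
  quasiOfArms_of TopSideToLeftMeetsTB_holds TopSideToRightMeetsTB_holds AlternatingTBMeet_holds
    CorridorA_holds

/-- **Lemma 5 (closing), periodic form** (`μ(𝓠(n, m)) · μ(𝓑(m)) ≤ μ(𝓑(n))`), unconditionally for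
every `k t`: `closingIneq_of` fed with the proved `PartsMeetMPath_holds`.
[cite: KohlerSchindlerTassion2023, Lemma 5 and Comment 1] -/
theorem ClosingIneq_holds (k t : ℕ) : Literature.Probability.Percolation.KSTPeriodic.ClosingIneq k t :=
  closingIneq_of PartsMeetMPath_holds k t

end KSTPeriodic

end Literature.Probability.Percolation
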